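import Summits.BirchSwinnertonDyer.Rank1Residual.ManinAdditive.CuspidalKummerClass
import Literature.NumberTheory.EllipticCurves.KatoAdditiveTwistedValueNeronIntegralitySymbolClosure
import Literature.NumberTheory.EllipticCurves.Isogeny
import Literature.NumberTheory.EllipticCurves.ModularCurve
import Mathlib.Algebra.Module.ZLattice.Covolume
import HarnessLib
import HarnessLib.Audit.Tags

/-!
# The PLUS-DEFECT of the cuspidal group and KATO'S CURVE `E_K = ℂ/𝓛̄_f`: polar witnesses, period divisibility,
# the law E-es-61, the support S-es-K, the documentation-grade law E-es-65 — BY NAME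
# (cell `bsd-f2-manin`, Euler-system lens `bsd-f2-manin-es` gen 14–17; typing asks T-es-20 (b)(c) / T-es-21 (ii)(iii))

HONEST FRAMING.  LENS = Euler systems / Kato's explicit reciprocity law read at Kato's OWN curve
`E_K = E₀/ψ(C₀) = ℂ/(c·𝓛̄_f)` of the class (planner `bsd-f2-manin-es`, MEMO-es §27–§30; source file
HOME/es/Sketch-es-g17.lean 93557c1a115c1402, 897 l., farm rc 0 · 0 sorries · axioms standard; every `def` below is
that file's §0/§1 VERBATIM, re-keyed to the LANDED Literature vocabulary `IsSymbolClosureCurve` / `KatoFactTwoAt` /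
`KatoFactThreeAt` / `kato_isIntegral_twistedSymbolSum_{two,three}_symbolClosure`
(`Literature/NumberTheory/EllipticCurves/KatoAdditiveTwistedValueNeronIntegralitySymbolClosure.lean`, F-es-21♭K /
F-es-18♭K) instead of the sketch's private copies).  SETTING: `W` the `X₀(N)`-optimal curve with lattice-optimal datum
`D` (`Λ_W = c·Λ_f`), `𝓛̄_f = AddSubgroup.closure (range (modularSymbol D.f))` the lattice of ALL modular symbols,
`ψ(C₀) ≅ 𝓛̄_f/Λ_f` the image of the cuspidal group, `E_K = ℂ/𝓛̄_f` Kato's curve, `E_min` Stevens' curve of maximal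
Néron covolume, `π⁺ = 2 re`.

* VOCABULARY (§0/§1): `ThreeAdicPolarWitness W V f` / `TwoAdicPolarWitness W V f` (a tame EVEN polar character
  whose symmetrised twisted value is a `p`-adic UNIT against `Ω(W)`, read through the member `V`),
  `CuspidalRealPartPrimeToThree D` (g16 intersection form), **`CuspidalPlusDefectPrimeTo p D`** (`pd_p = 0`: every
  symbol `x ∈ 𝓛̄_f` has a prime-to-`p` multiple `n` with `n(x + x̄) = y + ȳ`, `y ∈ Λ_f` — the C3 v10 CUT PREDICATE
  «stub_5ⁿ := RES₃♭ ∧ `CuspidalPlusDefectPrimeTo 3 D`», refuter-1 §R60 R-1: well-typed, decidable per class),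
  `CuspidalReducedPlusDefectPrimeTo p D` (`pd_p = s_p`), `PeriodDividesAt p V W` (`Ω(W) ∣_p Ω(V)`),
  `PPeriodEquiv p V V'`, `IsMaxCovolumeInClass V` (Stevens' `E_min`), `IsStevensMinimalAt p W` (`t_p = 0`).
* **E-es-61 `ThreeAdicUnitWitnessOfNoRationalThreeTorsion`** (LAW, `@[conjecture]`): lattice-optimal `W`, `9 ∣ N`, no
  rational point of order `3` on the short model ⟹ a `3`-adic unit even polar witness against `Ω(W)` (E28 + E38:
  86 / 86 classes).
* **S-es-K `KatoCurveExists`** (SUPPORT, `@[conjecture]` as an unproved tree obligation; TRUE ON PAPER — Vélu quotient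
  by the Galois-stable `ψ(C₀)` + Néron model, refuter-1 §R60): Kato's curve has a globally minimal model over `ℚ`
  isogenous to `W` with Néron lattice a positive real multiple of `𝓛̄_f`.
* **E-es-63 `KatoCurvePeriodDvdOfNoPlusDefect`** with inputs (A) `NeronLatticeRePartAttained`, (B)
  `SymbolClosureScalarIsMultiple` — plain `def`s, ALL THREE PROVED in the sibling
  `KatoCurvePlusDefectProofs.lean` (`…_holds`; es g17 §2, refuter-1 §R60 (b): no hidden hypothesis).
* **E-es-65 `KatoSharpIffNoReducedPlusDefect`** (LAW, `@[conjecture]`, DOCUMENTATION-GRADE per refuter-1 §R60 R-2: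
  `IsStevensMinimalAt` is inhabited on paper but not dischargeable in-tree; no line item may depend on discharging it).
Retired and NOT typed: E-es-60 (two-sided period law; its load-bearing half is the THEOREM E-es-63; refuter-1 §R60 R-4).
The levers / corollaries (`not_three_dvd_maninConstant_of_noPlusDefect'`, the law-free `p = 2` twin, the one-sided
witness transfers) are PROVED in the sibling `KatoCurvePlusDefectLevers.lean`; the stub-shape corollaries
`…_of_noPlusDefect_stub` need `ManinLocalTwoThree.not_good_and_not_mult_of_sq_dvd_level` (route cone) and are handed
to the C3 lead (`Theorems/`).

REFUTER STATUS at filing (refuter-1 §R60, HOME/ref1/R60-ref1-es-g16g17.md 12dfd195007ccb26, 2026-08-28T11:56Z;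
§R56 e88987aa76bfabc9 for the `p = 2` vocabulary): E-es-61 SURVIVES (LAW); E-es-63/(A)/(B) PROVED re-checked; E-es-65
SURVIVES as documentation-grade LAW; S-es-K SURVIVES (support, true on paper, `∃` pinned to `E_K`); interfaces F-5
faithful (junk `p`: `p = 0` harmless, `p = 1` makes the three `p`-predicates FALSE — E-es-65 carries `p.Prime`);
16 / 16 BC7 CLEAN in summit mode.  Refuter-2 placement (R-es-28/30: Vatsal 2005 integral periods, Delbourgo 2008
Def. 9.17 / Prop. 9.20) pending.  Currency PARTITION 0; beyond-print theorem: no.  BSD is not proved by this; Manin's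
conjecture is not proved by this.
-/

set_option autoImplicit false

noncomputable section

open scoped Classical MatrixGroups ModularForm ComplexConjugate

open CongruenceSubgroup Complex WeierstrassCurve Literature.NumberTheory.EllipticCurves
  Literature.NumberTheory.EllipticCurves.ModularForms

namespace Summit.BirchSwinnertonDyer.Rank1Residual.ManinAdditive.KatoCurve

open Summit.BirchSwinnertonDyer.Rank1Residual.ManinAdditive.CuspidalKummer
  Summit.BirchSwinnertonDyer.Rank1Residual.ManinAdditive.CuspidalKummerThree

/-! ## §0 Polar witnesses and the g16 intersection form -/

/-- **The `3`-adic EVEN POLAR WITNESS of `(W, V, f)`**: a tame even primitive character `χ` of conductor `m ⊥ 3N`,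
`χ ≠ 1`, `3 ∤ ord χ`, `χ(3) ∉ {±1}`, read through the member `V` of the class of `f` (newform of `V`, `V` additive at
`3`), with `ρ·Ω(V) = Ω(W)` and symmetrised twisted value `e_S(χ)·S_χ = r·Ω⁺_f`, such that `s·r·ρ/3` is NOT an
algebraic integer for any `s ⊥ 3` — i.e. the value is a `3`-adic UNIT against `Ω(W)`.  VERBATIM es g16/g17
(Sketch-es-g17 :112; refuter-1 §R60 F-5 faithful). [cite: Kato2004Asterisque, Thm. 6.6 (1) (p. 163) (shape of the twisted value; the witness predicate is the cell's, MEMO-es §29.5)] -/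
def ThreeAdicPolarWitness (W V : WeierstrassCurve ℚ) [V.IsElliptic] {N : ℕ} [NeZero N]
    (f : CuspForm (Gamma0 N) 2) : Prop :=
  ∃ (m : ℕ) (_ : NeZero m) (χ : DirichletCharacter ℂ m) (r : ℂ) (ρ : ℚ),
    IsNewformOf V f ∧ ¬ V.HasGoodReductionAtPrime 3 ∧ ¬ V.HasMultiplicativeReductionAtPrime 3 ∧
    m.Coprime (3 * N) ∧ χ.IsPrimitive ∧ χ ≠ 1 ∧ ¬ 3 ∣ orderOf χ ∧
    χ (3 : ZMod m) ≠ 1 ∧ χ (3 : ZMod m) ≠ -1 ∧ χ.Even ∧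
    (ρ : ℝ) * V.realPeriodRat = W.realPeriodRat ∧
    (∏ ℓ ∈ N.primeFactors with ¬ ℓ ^ 2 ∣ N,
        (((ℓ : ℂ) - (V.LFunction ℓ : ℂ) * χ (ℓ : ZMod m)) *
          ((ℓ : ℂ) - (V.LFunction ℓ : ℂ) * (χ (ℓ : ZMod m))⁻¹))) *
        twistedSymbolSum f χ = r * (plusPeriod f : ℂ) ∧
    ∀ s : ℕ, ¬ 3 ∣ s → ¬ _root_.IsIntegral ℤ ((s : ℂ) * r * (ρ : ℂ) / 3)


/-- **g16's local invariant at `3` (intersection form): the REAL PART of the symbol lattice is prime-to-`3` over the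
periods** — every real `x` with `x ∈ 𝓛̄_f` has a multiple `n·x ∈ Λ_f` with `3 ∤ n`.  Equivalent to
`CuspidalPlusDefectPrimeTo 3 D` (`cuspidalPlusDefectPrimeTo_three_iff`, PROVED in the proofs sibling).  VERBATIM es g16/g17
(Sketch-es-g17 :126). [cite: Stevens1989, §1 (cuspidal group and lattices of modular symbols; the prime-to-3 real-part predicate is the cell's, MEMO-es §29.5)] -/
def CuspidalRealPartPrimeToThree {W : WeierstrassCurve ℚ} {N : ℕ} [NeZero N]
    (D : ModularParametrizationData W N) : Prop :=
  ∀ x : ℝ, (x : ℂ) ∈ AddSubgroup.closure (Set.range (modularSymbol D.f)) →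
    ∃ n : ℕ, ¬ 3 ∣ n ∧ (((n : ℝ) * x : ℝ) : ℂ) ∈ periodLattice D.f


/-- **The `2`-adic POLAR WITNESS of `(W, V, f)`** (the `p = 2` twin: odd-order primitive `χ`, `χ(8) ≠ 1`, value a
`2`-adic unit against `Ω(W)`).  VERBATIM es g14/g17 (Sketch-es-g17 :159; refuter-1 §R56). [cite: Kato2004Asterisque, Thm. 6.6 (1) (p. 163) (shape of the twisted value; the witness predicate is the cell's, MEMO-es §27)] -/
def TwoAdicPolarWitness (W V : WeierstrassCurve ℚ) [V.IsElliptic] {N : ℕ} [NeZero N]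
    (f : CuspForm (Gamma0 N) 2) : Prop :=
  ∃ (m : ℕ) (_ : NeZero m) (χ : DirichletCharacter ℂ m) (r : ℂ) (ρ : ℚ),
    IsNewformOf V f ∧ ¬ V.HasGoodReductionAtPrime 2 ∧ ¬ V.HasMultiplicativeReductionAtPrime 2 ∧
    m.Coprime (2 * N) ∧ χ.IsPrimitive ∧ χ ≠ 1 ∧ ¬ 2 ∣ orderOf χ ∧ χ (8 : ZMod m) ≠ 1 ∧
    (ρ : ℝ) * V.realPeriodRat = W.realPeriodRat ∧
    (∏ ℓ ∈ N.primeFactors with ¬ ℓ ^ 2 ∣ N,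
        (((ℓ : ℂ) - (V.LFunction ℓ : ℂ) * χ (ℓ : ZMod m)) *
          ((ℓ : ℂ) - (V.LFunction ℓ : ℂ) * (χ (ℓ : ZMod m))⁻¹))) *
        twistedSymbolSum f χ = r * (plusPeriod f : ℂ) ∧
    ∀ s : ℕ, ¬ 2 ∣ s → ¬ _root_.IsIntegral ℤ ((s : ℂ) * r * (ρ : ℂ) / 2)


/-! ## §1 The plus-defect, period divisibility, Stevens-minimality -/

/-- **THE PLUS-DEFECT OF THE CUSPIDAL GROUP IS PRIME TO `p`** (`pd_p = 0`; lattice form, `c`-free, `p`-uniform):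
every modular symbol `x ∈ 𝓛̄_f` has a prime-to-`p` multiple `n` with `n·(x + x̄) = y + ȳ` for a period `y ∈ Λ_f`,
i.e. the `p`-part of `[π⁺𝓛̄_f : π⁺Λ_f]` is trivial (`π⁺ = 2 re`).  Cassels / Milne: `[π⁺𝓛̄_f : π⁺Λ_f] = #ker_ℝ/#coker_ℝ`
of the cuspidal isogeny `W(ℝ) → E_K(ℝ)`.  At `p = 3` it is `CuspidalRealPartPrimeToThree`; at `p = 2` it also sees
the component group (census E39, HOME/es/E39-PLUS-DEFECT-STRUCTURE-v1.tsv 0965e34642bb3507: `pd₂ = 0` on 219 / 277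
optimal classes `N ≤ 360`).  THE C3 v10 CUT PREDICATE: «stub_5ⁿ := RES₃♭ ∧ `CuspidalPlusDefectPrimeTo 3 D`»
(refuter-1 §R60 R-1: well-typed, decidable per class, closed in stub shape by {`exists_isNewformOf`, F-es-18♭K,
E-es-61, S-es-K}).  VERBATIM es g17 (Sketch-es-g17 :178). [cite: Stevens1989, §1 (lattices of modular symbols and the cuspidal group; the prime-to-p plus-defect predicate is the cell's, MEMO-es §30.2)] -/
def CuspidalPlusDefectPrimeTo (p : ℕ) {W : WeierstrassCurve ℚ} {N : ℕ} [NeZero N]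
    (D : ModularParametrizationData W N) : Prop :=
  ∀ x ∈ AddSubgroup.closure (Set.range (modularSymbol D.f)),
    ∃ n : ℕ, ¬ p ∣ n ∧ ∃ y ∈ periodLattice D.f, (n : ℂ) * (x + conj x) = y + conj y


/-- **NO REDUCED PLUS-DEFECT at `p`** (`pd_p = s_p`): for some `s`, the full layer `W[p^s]` is cuspidal
(`p^{-s}Λ_f ⊆ 𝓛̄_f`, forcing `pd_p ≥ s`) AND `p^s` kills the `p`-part of `π⁺𝓛̄_f/π⁺Λ_f` (`pd_p ≤ s`).  `pd_p = 0` is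
the case `s = 0` (`cuspidalReducedPlusDefectPrimeTo_of_plusDefect`, PROVED in the proofs sibling).  Junk values:
`p = 1` makes it FALSE (refuter-1 RB68b).  VERBATIM es g17 (Sketch-es-g17 :185). [cite: Stevens1989, §1 (as above; the reduced plus-defect predicate is the cell's, MEMO-es §30.2)] -/
def CuspidalReducedPlusDefectPrimeTo (p : ℕ) {W : WeierstrassCurve ℚ} {N : ℕ} [NeZero N]
    (D : ModularParametrizationData W N) : Prop :=
  ∃ s : ℕ, (∀ y ∈ periodLattice D.f, y / (p : ℂ) ^ s ∈ AddSubgroup.closure (Set.range (modularSymbol D.f))) ∧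
    ∀ x ∈ AddSubgroup.closure (Set.range (modularSymbol D.f)),
      ∃ n : ℕ, ¬ p ∣ n ∧ ∃ y ∈ periodLattice D.f, ((n * p ^ s : ℕ) : ℂ) * (x + conj x) = y + conj y


/-- **`Ω(W)` DIVIDES `Ω(V)` `p`-ADICALLY**: `d·Ω(V) = k·Ω(W)` with `k ∈ ℕ⁺`, `p ∤ d` (so `v_p(Ω(V)/Ω(W)) ≥ 0`).
VERBATIM es g17 (Sketch-es-g17 :192). [folklore] -/
def PeriodDividesAt (p : ℕ) (V W : WeierstrassCurve ℚ) : Prop :=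
  ∃ k d : ℕ, 0 < k ∧ ¬ p ∣ d ∧ (d : ℝ) * V.realPeriodRat = (k : ℝ) * W.realPeriodRat


/-- **`p`-ADIC EQUIVALENCE of real Néron periods** (`a·Ω(V) = b·Ω(V')`, `p ∤ ab`; es g15/g16's `TwoPeriodEquiv` /
`ThreePeriodEquiv` with `p` a parameter).  VERBATIM es g17 (Sketch-es-g17 :196). [folklore] -/
def PPeriodEquiv (p : ℕ) (V V' : WeierstrassCurve ℚ) : Prop :=
  ∃ a b : ℕ, ¬ p ∣ a ∧ ¬ p ∣ b ∧ (a : ℝ) * V.realPeriodRat = (b : ℝ) * V'.realPeriodRat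


/-- **`V` has MAXIMAL Néron covolume in its ℚ-isogeny class** (Stevens' `E_min` = minimal Faltings height; es g15,
VERBATIM Sketch-es-g17 :80).  Refuter-1 §R60 F-5: inhabited on paper for every class (`E_min` exists), NOT
instantiable in-tree (no isogeny-class enumeration) — consumers must assume it. [cite: Stevens1989, Thm. 2.3 (the curve of minimal height in an isogeny class; the covolume phrasing is the cell's, MEMO-es §28)] -/
def IsMaxCovolumeInClass (V : WeierstrassCurve ℚ) : Prop :=
  ∀ (V' : WeierstrassCurve ℚ) (L L' : PeriodPair), V'.IsElliptic → V'.IsGloballyMinimal →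
    IsIsogenous V V' → IsNeronLatticeOf (V.baseChange ℂ) L → IsNeronLatticeOf (V'.baseChange ℂ) L' →
    ZLattice.covolume L'.lattice ≤ ZLattice.covolume L.lattice

/-- **`W` is STEVENS-`p`-MINIMAL (`t_p = 0`)**: it is prime-to-`p` isogenous to the curve of maximal Néron covolume
`E_min` of its class (E39: 254 / 277 optimal classes at `p = 2`, 57 / 59 at `p = 3`).  The tree's `Isogeny` is a
genuine structure (`degree = Nat.card ker`), so the semantics is Stevens' «`E → E_min` of degree prime to `p`»;
documentation-grade (refuter-1 §R60 R-2).  VERBATIM es g17 (Sketch-es-g17 :201). [cite: Stevens1989, Thm. 2.3 (étale isogenies out of the minimal curve; the predicate is the cell's, MEMO-es §30.4)] -/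
def IsStevensMinimalAt (p : ℕ) (W : WeierstrassCurve ℚ) : Prop :=
  ∃ (Vm : WeierstrassCurve ℚ) (φ : Isogeny W Vm), Vm.IsElliptic ∧ Vm.IsGloballyMinimal ∧
    IsMaxCovolumeInClass Vm ∧ ¬ p ∣ φ.degree


/-! ## §2 The law E-es-61, the support S-es-K, the theorem E-es-63 (def; proof in the sibling), the law E-es-65 -/

/-- **E-es-61 `ThreeAdicUnitWitnessOfNoRationalThreeTorsion`** (cell bsd-f2-manin, es g16 LAW; nothing asserted):
for a lattice-optimal `W` with `9 ∣ N` and NO rational point of order `3` on the short model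
(`∀ X₀ Y₀, ¬ IsShortThreeTorsion W D.c X₀ Y₀`, the C3 skeleton's form) some tame EVEN polar `χ` has
`e_S(χ)·S_χ/Ω(W)` a `3`-adic UNIT (`ThreeAdicPolarWitness W W D.f`; `c`-free).  Census E28 + E38 (BC5 witness):
`g_A = g_B = 0` on 86 / 86 classes (56 complete `≤ 300` + 30 RES₃′-type `≤ 600`; minimum mostly at
`(m, d) = (11, 5)`); contrast: rational-`T₃` classes have `g_A ∈ {0, 1}` (27a1, 54a1: `1`).  Why novel: the unit
twisted value exists even on the three real-line classes — the defect is purely the period.  Why it might fail: a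
class without rational `3`-torsion all of whose tame even polar values against `Ω(W)` are divisible by `3`
(0 / 86).  With F-es-18♭K and the THEOREM E-es-63 it gives `3 ∤ c₀` on the no-plus-defect locus
(`not_three_dvd_maninConstant_of_noPlusDefect'`, levers sibling).  REF1 §R60: SURVIVES (LAW; the `c`-dependence of
`IsShortThreeTorsion W D.c` is harmless: `shortModel ≅_ℚ W`, `D.c ≠ 0`); BC7 CLEAN.  VERBATIM es g17 (Sketch-es-g17
:132).  Beyond-print theorem: no.
[cite: Kato2004Asterisque, Thm. 6.6 (1) (p. 163) (shape only; the unit-witness law is the cell's E-es-61, NOT in print — MEMO-es §29.5)] -/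
@[conjecture]
def ThreeAdicUnitWitnessOfNoRationalThreeTorsion : Prop :=
  ∀ (W : WeierstrassCurve ℚ) [W.IsElliptic] [W.IsGloballyMinimal] {N : ℕ} [NeZero N]
    (D : ModularParametrizationData W N),
    (∀ z ∈ D.L.lattice, ∃ w ∈ periodLattice D.f, z = D.c * w) → 3 ^ 2 ∣ N →
    (∀ X₀ Y₀ : ℚ, ¬ IsShortThreeTorsion W D.c X₀ Y₀) → ThreeAdicPolarWitness W W D.f


/-- **S-es-K `KatoCurveExists`** (cell bsd-f2-manin, es g17 SUPPORT; an unproved tree obligation that is TRUE ON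
PAPER): for a lattice-optimal datum, Kato's curve `E_K = ℂ/(c·𝓛̄_f)` — the quotient of `E₀` by the Galois-stable
image `ψ(C₀)` of the cuspidal group (cusps are `ℚ(ζ_N)`-points permuted by Galois, `φ` is defined over `ℚ`) — has a
globally minimal model over `ℚ`, isogenous to `W`, whose Néron lattice is a positive real multiple of `𝓛̄_f` (in fact
`λ·|c|·𝓛̄_f`, `λ` the Néron scalar of `E₀ → E_K`, by input (B)).  WHY THE `∃` IS PINNED (refuter-1 §R60 R-3 / F-5):
the real scalar `u` and the isogeny clause exclude quadratic twists; the inner `IsNewformOf` of the consumers pins the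
class — not a junk witness.  Census: `E_K` identified in Cremona's class by full lattice match on 277 / 277 (`p = 2`
table E27 v2) + 59 / 59 (`p = 3`, E38) classes.  Paper proof: Vélu (quotient by a `ℚ`-rational finite subgroup) +
Néron minimal model + «pull-back of a Néron differential along a `ℚ`-isogeny of minimal curves is an integer
multiple» (`integral_neronScaling_of_isGloballyMinimal_holds`); formalization pending (no Vélu quotient over `ℚ` in
the tree).  The ONE remaining support of the stub-shape corollaries of the C3 v10 cut.  REF1 §R60: SURVIVES; BC7
CLEAN.  VERBATIM es g17 (Sketch-es-g17 :835).  Beyond-print theorem: no.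
[cite: Wuthrich2014, §3 (T = V_{Z_p}(f)(1) = T_p E_bullet: the curve of the class carrying Kato's lattice) and proof of Thm. 4 (quotients of E_0 by images of cusps are defined over Q)] -/
@[conjecture]
def KatoCurveExists : Prop :=
  ∀ (W : WeierstrassCurve ℚ) [W.IsElliptic] [W.IsGloballyMinimal] {N : ℕ} [NeZero N]
    (D : ModularParametrizationData W N),
    (∀ z ∈ D.L.lattice, ∃ w ∈ periodLattice D.f, z = D.c * w) →
    ∃ (VK : WeierstrassCurve ℚ) (_ : VK.IsElliptic) (_ : VK.IsGloballyMinimal),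
      IsIsogenous W VK ∧ IsSymbolClosureCurve VK D.f

/-- Input **(A) `NeronLatticeRePartAttained`** (PROVED in the sibling, `neronLatticeRePartAttained_holds`): the half
real Néron period is the real part of a period — the tree's
`ModularParametrizationData.exists_mem_lattice_re_eq_realPeriodRat_div_two` with `D.L` replaced by any Néron period
pair.  VERBATIM es g17 (Sketch-es-g17 :222). [folklore] -/
def NeronLatticeRePartAttained : Prop :=
  ∀ (V : WeierstrassCurve ℚ) [V.IsElliptic] (L : PeriodPair), IsNeronLatticeOf (V.baseChange ℂ) L →
    ∃ z ∈ L.lattice, z.re = V.realPeriodRat / 2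


/-- Input **(B) `SymbolClosureScalarIsMultiple`** (PROVED in the sibling, `symbolClosureScalarIsMultiple_holds`): the
scalar `u` of Kato's curve (`Λ_{E_K} = u·𝓛̄_f`) is a POSITIVE INTEGER multiple of `|c|` (isogeny multiplier
`exists_rat_mulLeft_lattice_le_of_isogeny` + Manin–Drinfeld + «a real self-multiplier of a lattice is an integer» +
`integral_neronScaling_of_isGloballyMinimal_holds`).  VERBATIM es g17 (Sketch-es-g17 :231). [folklore] -/
def SymbolClosureScalarIsMultiple : Prop :=
  ∀ (W : WeierstrassCurve ℚ) [W.IsElliptic] [W.IsGloballyMinimal] {N : ℕ} [NeZero N]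
    (D : ModularParametrizationData W N),
    (∀ z ∈ D.L.lattice, ∃ w ∈ periodLattice D.f, z = D.c * w) →
    ∀ (VK : WeierstrassCurve ℚ) [VK.IsElliptic] [VK.IsGloballyMinimal], IsIsogenous W VK →
      ∀ (L : PeriodPair) (u : ℝ), IsNeronLatticeOf (VK.baseChange ℂ) L → 0 < u →
        (∀ z : ℂ, z ∈ L.lattice ↔ ∃ w ∈ AddSubgroup.closure (Set.range (modularSymbol D.f)), z = (u : ℂ) * w) →
        ∃ k : ℕ, 0 < k ∧ u = (k : ℝ) * |(D.c : ℝ)|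


/-- **E-es-63 `KatoCurvePeriodDvdOfNoPlusDefect`** (cell bsd-f2-manin, es g17; A THEOREM — PROVED in the sibling
`KatoCurvePlusDefectProofs.lean`, `katoCurvePeriodDvdOfNoPlusDefect_holds`, from (A) and (B); the robust ONE-SIDED,
`p`-uniform, level-free form of the retired law E-es-60): for a lattice-optimal datum whose cuspidal group has
plus-defect prime to `p`, `Ω(W)` divides `Ω(E_K)` `p`-adically.  PROOF: `re Λ_W = |c|·ℤΩ⁺_f/2`, `Ω(E_K)/2 = u·re x₀`
for a symbol `x₀` (A), `n·2re x₀ = 2re y ∈ ℤΩ⁺_f` with `p ∤ n` (plus-defect), `u = k|c|` (B) ⟹ `n·Ω(E_K) = kj·Ω(W)`.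
Census E39: `v_p(Ω(E_K)/Ω(E₀)) ≥ 0` on 219 / 219 (`p = 2`) + 36 / 36 (`p = 3`) classes with `pd_p = 0`.  REF1 §R60
(b): no hidden hypothesis beyond lattice-optimality; BC7 CLEAN.  VERBATIM es g17 (Sketch-es-g17 :211).  Nearest print:
Delbourgo 2008 Def. 9.17 / Prop. 9.20 (defect `E₀` vs `C^min`); beyond-print theorem: no (elementary lattice
bookkeeping). [folklore] -/
def KatoCurvePeriodDvdOfNoPlusDefect : Prop :=
  ∀ (p : ℕ) (W : WeierstrassCurve ℚ) [W.IsElliptic] [W.IsGloballyMinimal] {N : ℕ} [NeZero N]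
    (D : ModularParametrizationData W N),
    (∀ z ∈ D.L.lattice, ∃ w ∈ periodLattice D.f, z = D.c * w) → CuspidalPlusDefectPrimeTo p D →
    ∀ (VK : WeierstrassCurve ℚ) [VK.IsElliptic] [VK.IsGloballyMinimal],
      IsIsogenous W VK → IsSymbolClosureCurve VK D.f → PeriodDividesAt p VK W


/-- **E-es-65 `KatoSharpIffNoReducedPlusDefect`** (cell bsd-f2-manin, es g17 LAW; DOCUMENTATION-GRADE; nothing
asserted): on the Stevens-`p`-minimal locus (`t_p = 0`), `Ω(E_K) ∼_p Ω(W)` iff the cuspidal group has NO REDUCED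
PLUS-DEFECT at `p`.  Census E39 (BC5 witness; engine HOME/es/e39-src/g17_e39.py 3d5790519e823871): structure identity
`bK_p = gain_p + pd_p − lam_p` on 277 / 277 (`p = 2`) + 59 / 59 (`p = 3`); on `t_p = 0`: `lam = s` and `bK = pd − s`
on 254 / 254 + 57 / 57 (additive: 161 / 161 at `4 ∣ N` = 141 sharp + 20 defective; 54 / 54 at `9 ∣ N` = 34 + 20);
archimedean reading at `p = 2`, `C₂ = ℤ/2`, `t = 0` (57 classes): `Δ < 0` ⟹ sharp 32 / 32, cuspidal point `= e₃`
sharp 6 / 6, `= e₁` defective 8 / 8, `= e₂` defective 11 / 11.  Theorem-in-principle: Stevens 1989 Thm. 2.3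
(`E_min → E` étale) + `Hom_ℚ(E_min, E_K)` cyclic + Cassels' `#ker_ℝ/#coker_ℝ`.  Why it might fail: a `t_p = 0` class
with `lam_p > s_p`.  REF1 §R60 R-2: SURVIVES as a LAW but DOCUMENTATION-GRADE — `IsStevensMinimalAt p W` is inhabited
on paper and NOT dischargeable in-tree; NO line item may depend on discharging it (a consumable form would state the
`t_p = 0` case through `CuspidalReducedPlusDefectPrimeTo` + an explicit per-class hypothesis «`W` = its own `E_min` at
`p`»); junk `p = 1` excluded by `p.Prime`.  VERBATIM es g17 (Sketch-es-g17 :248).  Beyond-print theorem: no.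
[cite: Stevens1989, Thm. 2.3 (shape only: étale isogenies from the minimal curve; the sharpness law is the cell's E-es-65, NOT in print — MEMO-es §30.4)] -/
@[conjecture]
def KatoSharpIffNoReducedPlusDefect : Prop :=
  ∀ (p : ℕ), p.Prime → ∀ (W : WeierstrassCurve ℚ) [W.IsElliptic] [W.IsGloballyMinimal] {N : ℕ} [NeZero N]
    (D : ModularParametrizationData W N),
    (∀ z ∈ D.L.lattice, ∃ w ∈ periodLattice D.f, z = D.c * w) → IsStevensMinimalAt p W →
    ∀ (VK : WeierstrassCurve ℚ) [VK.IsElliptic] [VK.IsGloballyMinimal],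
      IsIsogenous W VK → IsSymbolClosureCurve VK D.f →
      (PPeriodEquiv p VK W ↔ CuspidalReducedPlusDefectPrimeTo p D)


end Summit.BirchSwinnertonDyer.Rank1Residual.ManinAdditive.KatoCurve

end
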